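import Mathlib
import Summits.Ventures.HodgeRepro2.Tier7.Line1.SepBar
import Summits.Ventures.HodgeRepro2.Tier7.Line1.SepMultOne

/-!
# Tier7/Line1/SepShadow — the `SurfaceShadow` of the separating datum

The SEPARATING DATUM of t7-L1-p2 (LINE L1, residual probe). `∫_X` is the coefficient of `t₁ t₂` (`intX`); it is
Hecke-invariant (`intX_act`) and real (`intX_bar`); Hodge–Riemann on `H10 * H10 = ι(M)`:
`∫ (ι x) (ι x)‾ = ∑ k ‖x k‖²_{ℓ²} > 0` for `x ≠ 0` (`hr_pos`). With (H9) `H20_semisimple'` and (H10) `H20_multone'` of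
`SepMultOne`, this assembles the `SurfaceShadow (HXS J) G` of the frozen `Target.lean` (`shadow`).
Author: t7-L1-p2 (prover-pub-hodge-repro2-t7-L1-p2-g0-0). §8(d): NO.
-/

namespace Summit.Ventures.HodgeRepro2.Tier7.Line1.Sep

open Finset Summit.Ventures.HodgeRepro2.Tier7

noncomputable section

variable {J : Type} [AddCommGroup J] [Module ℂ J]

/-! ## The integral -/

/-- `∫_X`: the coefficient of `t₁ t₂` -/
def intX : HXS J →ₗ[ℂ] ℂ :=
  (Curve.tL (R := ℂ) (V := V₁) (J := Unit) (β := β₁)).comp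
    (Curve.tL (R := A₁) (V := V₂) (J := Junk J) (β := β₂))

/-- `intX` unfolded -/
theorem intX_apply (x : HXS J) : intX x = x.t.t := rfl

/-- a generator datum whose `σ₁` preserves the top coefficient preserves the integral -/
theorem HAutData.intX_algEquiv (D : HAutData) (hσ : ∀ y, (D.σ₁ y).t = y.t) (a : HXS J) :
    intX (D.algEquiv a) = intX a := by
  rw [intX_apply, intX_apply, HAutData.algEquiv_apply]
  exact hσ _

/-- every generator preserves the integral -/
theorem intX_gen (s : Bool × Option ℕ) (a : HXS J) : intX (gen J s a) = intX a := by
  rcases s with ⟨b, n⟩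
  rcases b with _ | _ <;> rcases n with _ | n
  · exact HAutData.intX_algEquiv _ (fun _ => rfl) a
  · exact HAutData.intX_algEquiv _ (fun y => by rw [genData, HAutData.ofUAut, UAut.algEquiv₁_apply]) a
  · exact HAutData.intX_algEquiv _ (fun _ => rfl) a
  · exact HAutData.intX_algEquiv _ (fun y => by rw [genData, HAutData.ofUAut, UAut.algEquiv₁_apply]) a

/-- the integral is Hecke-invariant -/
theorem intX_act (g : G) (a : HXS J) : intX (g • a) = intX a :=
  lift_gen_prop (J := J) (fun φ => ∀ a, intX (φ a) = intX a) (fun a => by simp) intX_gen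
    (fun φ ψ hφ hψ a => by rw [AlgEquiv.mul_apply, hφ, hψ]) g a

/-- the integral is real -/
theorem intX_bar (jb : JBar J) (a : HXS J) : intX (barH jb a) = (starRingEnd ℂ) (intX a) := by
  rw [intX_apply, intX_apply, barH_apply]
  exact bar₁_t _

/-! ## Hodge–Riemann on `H10 * H10` -/

/-- `∫ (ι x) (ι x)‾ = ∑ k ‖x k‖²` -/
theorem intX_mul_barH_ι (jb : JBar J) (x : M) :
    intX (ι x * barH jb (ι x)) = ∑ k, ((‖toLp (x k)‖ ^ 2 : ℝ) : ℂ) := by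
  rw [barH_ι, intX_apply, Curve.mul_t, ι_apply]
  simp only [β₂_apply, mul_zero, zero_add, add_zero, holA_mul_antiA, Bform_conjU_self,
    Pi.zero_apply]
  have h := map_sum (Curve.tL (R := ℂ) (V := V₁) (J := Unit) (β := β₁))
    (fun k => ((‖toLp (x k)‖ ^ 2 : ℝ) : ℂ) • topA) Finset.univ
  simp only [Curve.tL_apply] at h
  rw [h]
  simp [topA]

/-- HODGE–RIEMANN: `∫ a ā > 0` for `0 ≠ a ∈ H10 * H10` -/
theorem hr_pos (jb : JBar J) (a : HXS J) (ha : a ∈ (H10 : Submodule ℂ (HXS J)) * H10) (h0 : a ≠ 0) :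
    0 < (intX (a * barH jb a)).re := by
  rw [H10_mul_H10] at ha
  obtain ⟨x, rfl⟩ := ha
  rw [intX_mul_barH_ι, ← Complex.ofReal_sum, Complex.ofReal_re]
  have hx : x ≠ 0 := fun h => h0 (by rw [h]; exact map_zero ι)
  obtain ⟨k, hk⟩ : ∃ k, x k ≠ 0 := by
    by_contra h
    push Not at h
    exact hx (funext h)
  refine Finset.sum_pos' (fun k _ => by positivity) ⟨k, Finset.mem_univ k, ?_⟩
  have : toLp (x k) ≠ 0 := fun h => hk (toLp_injective (by rw [h]; exact (map_zero toLp).symm))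
  positivity

/-! ## The surface shadow -/

/-- THE SURFACE SHADOW of the separating datum -/
def shadow (jb : JBar J) : SurfaceShadow (HXS J) G where
  H10 := H10
  act_add g a b := map_add (FreeGroup.lift (gen J) g) a b
  act_mul g a b := map_mul (FreeGroup.lift (gen J) g) a b
  act_smul g c a := map_smul (FreeGroup.lift (gen J) g) c a
  act_H10 := act_H10
  bar := barH jb
  bar_add := barH_add jb
  bar_smul := barH_smul jb
  bar_mul := barH_mul jb
  bar_bar := barH_barH jb
  bar_act := bar_act jb
  intX := intX
  intX_act := intX_act
  intX_bar := intX_bar jb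
  comm_H20 _ _ _ _ := mul_comm _ _
  hr_pos := hr_pos jb
  H20_semisimple := H20_semisimple'
  H20_multone := H20_multone'

/-- the `L²` pairing of the shadow -/
theorem shadow_L2 (jb : JBar J) (a b : HXS J) : (shadow jb).L2 a b = intX (a * barH jb b) := rfl

/-- the `H10` of the shadow -/
theorem shadow_H10 (jb : JBar J) : (shadow jb).H10 = H10 := rfl

end

end Summit.Ventures.HodgeRepro2.Tier7.Line1.Sep
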